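import Mathlib

/-!
# Lemmas for the GPT slack factorisation (`PermanentalConeHard`, stub `stub_shadowSlackFactor`)

Support file for the crux
`Summit.ValiantsHypothesis.ValiantsHypothesis.Theses.PermanentalCones.PermanentalConeHard`
(item `stmt-ValiantsHypothesis-8654`), line `registered`, stub `stub_shadowSlackFactor`, whose proof
(finite-dimensional conic duality for a lifted LMI after facial reduction) lives in
`PermanentalConesPermanentalConeHardShadowSlackFactor.lean`.  This file collects the self-contained
linear-algebra / topology / convexity lemmas it needs, all over `ℝ` with `Fin m`-indexed matrices
and the quadratic form `u ↦ uᵀ Y u = u ⬝ᵥ (Y *ᵥ u)`: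

* quadratic-form algebra (`quadForm_*`), kernels of real positive semidefinite matrices
  (`mulVec_eq_zero_of_add`: `ker (P + Q) ⊆ ker P ∩ ker Q`; `quadForm_pos_on_range`: the form of a
  psd `S` is positive on `range S ∖ 0`), and the decomposition `ℝᵐ = ker S + range S` for symmetric
  `S` (`exists_ker_add_range`, by rank–nullity);
* `isOpen_setOf_facePos`: openness of `{Y | ∀ b ∈ range S ∖ 0, bᵀ (X − Y) b > 0}` (generalized tube
  lemma over the compact set `sphere ∩ range S`, plus homogeneity);
* `exists_linear_lt`: geometric Hahn–Banach (`geometric_hahn_banach_open_point`) in `F × ℝ`,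
  normalised to "an open convex set missing `(0,0)` and containing `(0,t₀)`, `t₀ > 0`, lies strictly
  below the graph of a linear functional";
* `exists_psd_repr`: a linear functional on `Mat_m(ℝ)` that is `≤ 0` on matrices with nonpositive
  quadratic form is `Y ↦ tr (Y * Λ)` with `Λ ⪰ 0` (`Λ i j := Lf (E_ij)`); its `∀`-form is the
  registered sub-goal `stub_shadowSlackPsdRepr` of the item (stated on one line, verbatim as
  registered, so that this helper file lands with `--supports`).
-/

set_option linter.dupNamespace false

namespace Summit.ValiantsHypothesis.ValiantsHypothesis.Theorems.PermanentalConesPermanentalConeHard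

namespace ShadowSlack

open scoped Matrix

variable {m : ℕ}

/-! ### Quadratic-form algebra over `ℝ` -/

/-- `uᵀ (a Y₁ + b Y₂) u = a uᵀ Y₁ u + b uᵀ Y₂ u`. -/
theorem quadForm_add_smul (Y₁ Y₂ : Matrix (Fin m) (Fin m) ℝ) (a b : ℝ) (u : Fin m → ℝ) :
    u ⬝ᵥ ((a • Y₁ + b • Y₂) *ᵥ u) = a * (u ⬝ᵥ (Y₁ *ᵥ u)) + b * (u ⬝ᵥ (Y₂ *ᵥ u)) := by
  rw [Matrix.add_mulVec, Matrix.smul_mulVec, Matrix.smul_mulVec, dotProduct_add, dotProduct_smul,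
    dotProduct_smul, smul_eq_mul, smul_eq_mul]

/-- Homogeneity: `(r u)ᵀ Y (r u) = r² uᵀ Y u`. -/
theorem quadForm_smul_self (Y : Matrix (Fin m) (Fin m) ℝ) (r : ℝ) (u : Fin m → ℝ) :
    (r • u) ⬝ᵥ (Y *ᵥ (r • u)) = r * r * (u ⬝ᵥ (Y *ᵥ u)) := by
  rw [Matrix.mulVec_smul, dotProduct_smul, smul_dotProduct, smul_eq_mul, smul_eq_mul, mul_assoc]

/-- `uᵀ Y u` as a double sum. -/
theorem quadForm_eq_sum (Y : Matrix (Fin m) (Fin m) ℝ) (w : Fin m → ℝ) :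
    w ⬝ᵥ (Y *ᵥ w) = ∑ i, ∑ j, w i * w j * Y i j := by
  simp only [dotProduct, Matrix.mulVec, Finset.mul_sum]
  exact Finset.sum_congr rfl fun i _ => Finset.sum_congr rfl fun j _ => by ring

/-- `uᵀ (w vᵀ) u = (uᵀ w) (vᵀ u)`. -/
theorem quadForm_vecMulVec (w v u : Fin m → ℝ) :
    u ⬝ᵥ (Matrix.vecMulVec w v *ᵥ u) = (u ⬝ᵥ w) * (v ⬝ᵥ u) := by
  have h : Matrix.vecMulVec w v *ᵥ u = (v ⬝ᵥ u) • w := by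
    ext i
    simp only [Matrix.mulVec, dotProduct, Matrix.vecMulVec_apply, Pi.smul_apply, smul_eq_mul,
      Finset.sum_mul]
    exact Finset.sum_congr rfl fun j _ => by ring
  rw [h, dotProduct_smul, smul_eq_mul, mul_comm]

/-- `uᵀ E_ij u = u_i u_j`. -/
theorem quadForm_single (i j : Fin m) (u : Fin m → ℝ) :
    u ⬝ᵥ (Matrix.single i j (1 : ℝ) *ᵥ u) = u i * u j := by
  rw [Matrix.single_eq_single_vecMulVec_single, quadForm_vecMulVec, dotProduct_single,
    single_dotProduct]
  ring

/-- `0 < uᵀ u` for `u ≠ 0`. -/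
theorem dotProduct_self_pos_of_ne_zero {u : Fin m → ℝ} (hu : u ≠ 0) : 0 < u ⬝ᵥ u := by
  have h := Matrix.dotProduct_star_self_pos_iff.2 hu
  rwa [star_trivial] at h

/-- A real Hermitian matrix is symmetric. -/
theorem transpose_eq_of_isHermitian {M : Matrix (Fin m) (Fin m) ℝ} (hM : M.IsHermitian) :
    Mᵀ = M := by
  have h := hM.eq
  rwa [Matrix.conjTranspose_eq_transpose_of_trivial] at h

/-- For symmetric `M` with `M a = 0`: `(a + b)ᵀ M (a + b) = bᵀ M b`. -/
theorem quadForm_add_of_mulVec_eq_zero {M : Matrix (Fin m) (Fin m) ℝ} (hM : M.IsHermitian)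
    {a : Fin m → ℝ} (ha : M *ᵥ a = 0) (b : Fin m → ℝ) :
    (a + b) ⬝ᵥ (M *ᵥ (a + b)) = b ⬝ᵥ (M *ᵥ b) := by
  have h1 : a ⬝ᵥ (M *ᵥ b) = 0 := by
    rw [Matrix.dotProduct_mulVec, ← Matrix.mulVec_transpose, transpose_eq_of_isHermitian hM, ha,
      zero_dotProduct]
  rw [Matrix.mulVec_add, ha, zero_add, add_dotProduct, h1, zero_add]

/-! ### Kernels of real positive semidefinite matrices -/

/-- `0 ≤ xᵀ P x` for real psd `P`. -/
theorem quadForm_nonneg {P : Matrix (Fin m) (Fin m) ℝ} (hP : P.PosSemidef) (x : Fin m → ℝ) :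
    0 ≤ x ⬝ᵥ (P *ᵥ x) := by
  simpa only [star_trivial] using hP.dotProduct_mulVec_nonneg x

/-- `xᵀ P x = 0 → P x = 0` for real psd `P`. -/
theorem mulVec_eq_zero_of_quadForm_eq_zero {P : Matrix (Fin m) (Fin m) ℝ} (hP : P.PosSemidef)
    {x : Fin m → ℝ} (h : x ⬝ᵥ (P *ᵥ x) = 0) : P *ᵥ x = 0 := by
  have h' := hP.dotProduct_mulVec_zero_iff x
  rw [star_trivial] at h'
  exact h'.1 h

/-- `ker (P + Q) ⊆ ker P ∩ ker Q` for real psd `P, Q`. -/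
theorem mulVec_eq_zero_of_add {P Q : Matrix (Fin m) (Fin m) ℝ} (hP : P.PosSemidef)
    (hQ : Q.PosSemidef) {x : Fin m → ℝ} (h : (P + Q) *ᵥ x = 0) : P *ᵥ x = 0 ∧ Q *ᵥ x = 0 := by
  have hsum : x ⬝ᵥ (P *ᵥ x) + x ⬝ᵥ (Q *ᵥ x) = 0 := by
    rw [← dotProduct_add, ← Matrix.add_mulVec, h, dotProduct_zero]
  have h1 := quadForm_nonneg hP x
  have h2 := quadForm_nonneg hQ x
  exact ⟨mulVec_eq_zero_of_quadForm_eq_zero hP (by linarith),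
    mulVec_eq_zero_of_quadForm_eq_zero hQ (by linarith)⟩

/-- For a real psd `S`: `S c ≠ 0 → 0 < (S c)ᵀ S (S c)` (the form of `S` is positive on
`range S ∖ 0`). -/
theorem quadForm_pos_on_range {S : Matrix (Fin m) (Fin m) ℝ} (hS : S.PosSemidef)
    {c : Fin m → ℝ} (hc : S *ᵥ c ≠ 0) : 0 < (S *ᵥ c) ⬝ᵥ (S *ᵥ (S *ᵥ c)) := by
  refine lt_of_le_of_ne (quadForm_nonneg hS _) fun h => hc ?_
  have h2 : S *ᵥ (S *ᵥ c) = 0 := mulVec_eq_zero_of_quadForm_eq_zero hS h.symm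
  have h3 : (S *ᵥ c) ⬝ᵥ (S *ᵥ c) = 0 := by
    rw [Matrix.dotProduct_mulVec, ← Matrix.mulVec_transpose, transpose_eq_of_isHermitian hS.1, h2,
      zero_dotProduct]
  exact dotProduct_self_eq_zero.1 h3

/-- For a real symmetric `S`, `ℝᵐ = ker S + range S` (rank–nullity and `ker S ∩ range S = 0`). -/
theorem exists_ker_add_range {S : Matrix (Fin m) (Fin m) ℝ} (hS : S.IsHermitian)
    (u : Fin m → ℝ) : ∃ a c, S *ᵥ a = 0 ∧ u = a + S *ᵥ c := by
  have hST := transpose_eq_of_isHermitian hS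
  have hdisj : LinearMap.range S.mulVecLin ⊓ LinearMap.ker S.mulVecLin = ⊥ := by
    rw [eq_bot_iff]
    rintro b ⟨hb1, hb2⟩
    obtain ⟨c, rfl⟩ := LinearMap.mem_range.1 hb1
    have h0 : S *ᵥ (S *ᵥ c) = 0 := by simpa using hb2
    have h3 : (S *ᵥ c) ⬝ᵥ (S *ᵥ c) = 0 := by
      rw [Matrix.dotProduct_mulVec, ← Matrix.mulVec_transpose, hST, h0, zero_dotProduct]
    rw [Submodule.mem_bot]
    simpa using dotProduct_self_eq_zero.1 h3
  have hsup : LinearMap.range S.mulVecLin ⊔ LinearMap.ker S.mulVecLin = ⊤ := by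
    apply Submodule.eq_top_of_finrank_eq
    have h1 := Submodule.finrank_sup_add_finrank_inf_eq (LinearMap.range S.mulVecLin)
      (LinearMap.ker S.mulVecLin)
    rw [hdisj, finrank_bot, add_zero, LinearMap.finrank_range_add_finrank_ker] at h1
    exact h1
  have hu : u ∈ LinearMap.range S.mulVecLin ⊔ LinearMap.ker S.mulVecLin := by
    rw [hsup]
    exact Submodule.mem_top
  obtain ⟨b, hb, a, ha, rfl⟩ := Submodule.mem_sup.1 hu
  obtain ⟨c, rfl⟩ := LinearMap.mem_range.1 hb
  refine ⟨a, c, by simpa using ha, ?_⟩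
  rw [Matrix.mulVecLin_apply, add_comm]

/-! ### Openness of the face-relative positivity condition -/

/-- For fixed `S, X`, the set of `Y` with `bᵀ (X - Y) b > 0` for all `b ∈ range S ∖ 0` is open
(generalized tube lemma over the compact set `sphere ∩ range S`, plus homogeneity). -/
theorem isOpen_setOf_facePos (S X : Matrix (Fin m) (Fin m) ℝ) :
    IsOpen {Y : Matrix (Fin m) (Fin m) ℝ |
      ∀ c, S *ᵥ c ≠ 0 → 0 < (S *ᵥ c) ⬝ᵥ ((X - Y) *ᵥ (S *ᵥ c))} := by
  rw [isOpen_iff_forall_mem_open]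
  intro Y₀ hY₀
  have hn : IsOpen {z : Matrix (Fin m) (Fin m) ℝ × (Fin m → ℝ) | 0 < z.2 ⬝ᵥ ((X - z.1) *ᵥ z.2)} :=
    isOpen_lt continuous_const (by fun_prop)
  have hT : IsCompact (Metric.sphere (0 : Fin m → ℝ) 1 ∩
      (LinearMap.range S.mulVecLin : Set (Fin m → ℝ))) :=
    (isCompact_sphere 0 1).inter_right (Submodule.closed_of_finiteDimensional _)
  obtain ⟨U, V, hU, -, hYU, hTV, hUV⟩ := generalized_tube_lemma isCompact_singleton hT hn (by
    rintro ⟨Y, b⟩ ⟨hY, hb1, hb2⟩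
    rw [Set.mem_singleton_iff] at hY
    subst hY
    obtain ⟨c, rfl⟩ := LinearMap.mem_range.1 hb2
    have hc : S *ᵥ c ≠ 0 := by
      intro h
      rw [mem_sphere_zero_iff_norm, Matrix.mulVecLin_apply, h, norm_zero] at hb1
      exact zero_ne_one hb1
    exact hY₀ c hc)
  refine ⟨U, fun Y hY c hc => ?_, hU, hYU (Set.mem_singleton Y₀)⟩
  have hnorm : 0 < ‖S *ᵥ c‖ := norm_pos_iff.2 hc
  have hmemT : ‖S *ᵥ c‖⁻¹ • (S *ᵥ c) ∈ Metric.sphere (0 : Fin m → ℝ) 1 ∩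
      (LinearMap.range S.mulVecLin : Set (Fin m → ℝ)) := by
    refine ⟨?_, ?_⟩
    · rw [mem_sphere_zero_iff_norm, norm_smul, norm_inv, norm_norm, inv_mul_cancel₀ hnorm.ne']
    · exact Submodule.smul_mem _ _ (LinearMap.mem_range.2 ⟨c, rfl⟩)
  have hz := hUV (Set.mk_mem_prod hY (hTV hmemT))
  simp only [Set.mem_setOf_eq] at hz
  rw [quadForm_smul_self] at hz
  exact pos_of_mul_pos_right hz (mul_self_nonneg _)

/-! ### Separation in `F × ℝ` and elementary inequalities -/

/-- Geometric Hahn–Banach, normalised: an open convex set in `F × ℝ` missing `(0, 0)` and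
containing a point `(0, t₀)` with `t₀ > 0` lies strictly below the graph of a linear functional. -/
theorem exists_linear_lt {F : Type*} [TopologicalSpace F] [AddCommGroup F] [Module ℝ F]
    [IsTopologicalAddGroup F] [ContinuousSMul ℝ F] {s : Set (F × ℝ)} (hconv : Convex ℝ s)
    (hopen : IsOpen s) (h0 : ((0 : F), (0 : ℝ)) ∉ s) {t₀ : ℝ} (ht₀ : 0 < t₀)
    (hmem : ((0 : F), t₀) ∈ s) : ∃ L : F →ₗ[ℝ] ℝ, ∀ Y t, (Y, t) ∈ s → L Y < t := by
  obtain ⟨f, hf⟩ := geometric_hahn_banach_open_point hconv hopen h0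
  have hf0 : f ((0 : F), (0 : ℝ)) = 0 := by rw [Prod.mk_zero_zero, map_zero]
  have hdecomp : ∀ (Y : F) (t : ℝ), f (Y, t) = f (Y, 0) + t * f (0, 1) := by
    intro Y t
    have h : ((Y, t) : F × ℝ) = (Y, 0) + t • ((0 : F), (1 : ℝ)) := by simp
    calc f (Y, t) = f ((Y, 0) + t • ((0 : F), (1 : ℝ))) := by rw [← h]
      _ = f (Y, 0) + t * f (0, 1) := by rw [map_add, map_smul, smul_eq_mul]
  have hμ : f (0, 1) < 0 := by
    have h1 := hf _ hmem
    rw [hf0, hdecomp, hf0, zero_add] at h1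
    exact neg_of_mul_neg_right h1 ht₀.le
  refine ⟨(-f (0, 1))⁻¹ • (f.toLinearMap.comp (LinearMap.inl ℝ F ℝ)), fun Y t hYt => ?_⟩
  have h1 := hf _ hYt
  rw [hf0, hdecomp] at h1
  simp only [LinearMap.smul_apply, LinearMap.comp_apply, LinearMap.inl_apply,
    ContinuousLinearMap.coe_coe, smul_eq_mul]
  rw [inv_mul_lt_iff₀ (neg_pos.2 hμ)]
  nlinarith

/-- `x < ε c` for all `ε > 0` forces `x ≤ 0`. -/
theorem nonpos_of_forall_pos_lt_mul {x c : ℝ} (h : ∀ ε : ℝ, 0 < ε → x < ε * c) : x ≤ 0 := by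
  by_contra hx
  rw [not_le] at hx
  rcases le_or_gt c 0 with hc | hc
  · have h1 := h 1 one_pos
    nlinarith
  · have h1 := h (x / (2 * c)) (by positivity)
    have h2 : x / (2 * c) * c = x / 2 := by
      field_simp
    rw [h2] at h1
    linarith

/-- A convex combination of two positive numbers is positive. -/
theorem convexComb_pos {a b p q : ℝ} (ha : 0 ≤ a) (hb : 0 ≤ b) (hab : a + b = 1)
    (hp : 0 < p) (hq : 0 < q) : 0 < a * p + b * q := by
  rcases ha.eq_or_lt with h | h
  · subst h
    rw [zero_add] at hab
    subst hab
    simpa using hq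
  · exact add_pos_of_pos_of_nonneg (mul_pos h hp) (mul_nonneg hb hq.le)

/-- Convex combinations preserve strict inequalities. -/
theorem convexComb_lt {a b p q s t : ℝ} (ha : 0 ≤ a) (hb : 0 ≤ b) (hab : a + b = 1)
    (hp : p < s) (hq : q < t) : a * p + b * q < a * s + b * t := by
  rcases ha.eq_or_lt with h | h
  · subst h
    rw [zero_add] at hab
    subst hab
    simpa using hq
  · have h1 := mul_lt_mul_of_pos_left hp h
    have h2 := mul_le_mul_of_nonneg_left hq.le hb
    linarith

/-! ### Linear functionals on matrices -/

/-- Expansion of a linear functional in the elementary matrices `E_ij = Matrix.single i j 1`. -/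
theorem apply_eq_sum_single (L : Matrix (Fin m) (Fin m) ℝ →ₗ[ℝ] ℝ)
    (Y : Matrix (Fin m) (Fin m) ℝ) : L Y = ∑ i, ∑ j, Y i j * L (Matrix.single i j 1) := by
  conv_lhs => rw [Matrix.matrix_eq_sum_single Y]
  rw [map_sum]
  refine Finset.sum_congr rfl fun i _ => ?_
  rw [map_sum]
  refine Finset.sum_congr rfl fun j _ => ?_
  rw [← smul_eq_mul, ← map_smul, Matrix.smul_single, smul_eq_mul, mul_one]

/-- **The multiplier matrix.**  A linear functional `Lf` on `Mat_m(ℝ)` that is `≤ 0` on every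
matrix with nonpositive quadratic form is `Y ↦ tr (Y * Λ)` for a positive semidefinite `Λ`
(namely `Λ i j := Lf (E_ij)`, symmetric since `Lf` kills `E_ij − E_ji`, psd since
`wᵀ Λ w = Lf (w wᵀ) ≥ 0`). -/
theorem exists_psd_repr (Lf : Matrix (Fin m) (Fin m) ℝ →ₗ[ℝ] ℝ)
    (hD : ∀ Nn : Matrix (Fin m) (Fin m) ℝ, (∀ u, u ⬝ᵥ (Nn *ᵥ u) ≤ 0) → Lf Nn ≤ 0) :
    ∃ Λ : Matrix (Fin m) (Fin m) ℝ, Λ.PosSemidef ∧ ∀ Y, Lf Y = Matrix.trace (Y * Λ) := by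
  set Λ : Matrix (Fin m) (Fin m) ℝ := Matrix.of fun i j => Lf (Matrix.single i j 1) with hΛ
  have hΛsymm : ∀ i j, Lf (Matrix.single i j 1) = Lf (Matrix.single j i 1) := by
    intro i j
    have hq : ∀ u : Fin m → ℝ,
        u ⬝ᵥ ((Matrix.single i j (1 : ℝ) - Matrix.single j i 1) *ᵥ u) = 0 := by
      intro u
      rw [Matrix.sub_mulVec, dotProduct_sub, quadForm_single, quadForm_single]
      ring
    have h1 := hD _ fun u => (hq u).le
    have h2 := hD (-(Matrix.single i j (1 : ℝ) - Matrix.single j i 1)) fun u => by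
      rw [Matrix.neg_mulVec, dotProduct_neg, hq, neg_zero]
    rw [map_neg] at h2
    have h3 : Lf (Matrix.single i j (1 : ℝ) - Matrix.single j i 1) = 0 :=
      le_antisymm h1 (by linarith)
    rwa [map_sub, sub_eq_zero] at h3
  have hΛherm : Λ.IsHermitian := by
    refine Matrix.IsHermitian.ext fun i j => ?_
    rw [star_trivial, hΛ, Matrix.of_apply, Matrix.of_apply]
    exact hΛsymm j i
  have hΛpsd : Λ.PosSemidef := by
    refine Matrix.PosSemidef.of_dotProduct_mulVec_nonneg hΛherm fun w => ?_
    rw [star_trivial]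
    have h1 : 0 ≤ Lf (Matrix.vecMulVec w w) := by
      have h := hD (-Matrix.vecMulVec w w) fun u => by
        rw [Matrix.neg_mulVec, dotProduct_neg, quadForm_vecMulVec, dotProduct_comm u w]
        exact neg_nonpos.2 (mul_self_nonneg _)
      rwa [map_neg, neg_nonpos] at h
    have h2 : w ⬝ᵥ (Λ *ᵥ w) = Lf (Matrix.vecMulVec w w) := by
      rw [apply_eq_sum_single Lf (Matrix.vecMulVec w w), quadForm_eq_sum]
      simp only [Matrix.vecMulVec_apply, hΛ, Matrix.of_apply]
    rw [h2]
    exact h1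
  refine ⟨Λ, hΛpsd, fun Y => ?_⟩
  rw [apply_eq_sum_single Lf Y]
  simp only [Matrix.trace, Matrix.diag_apply, Matrix.mul_apply, hΛ, Matrix.of_apply]
  exact Finset.sum_congr rfl fun i _ => Finset.sum_congr rfl fun j _ => by rw [hΛsymm i j]

end ShadowSlack

/-- **Registered sub-goal `stub_shadowSlackPsdRepr`** (the multiplier-matrix lemma, `∀`-form of
`ShadowSlack.exists_psd_repr`): a linear functional on `Mat_m(ℝ)` that is `≤ 0` on every matrix
with nonpositive quadratic form is `Y ↦ tr (Y * Λ)` for some positive semidefinite `Λ`. -/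
theorem stub_shadowSlackPsdRepr : ∀ (m : ℕ) (Lf : Matrix (Fin m) (Fin m) ℝ →ₗ[ℝ] ℝ), (∀ N : Matrix (Fin m) (Fin m) ℝ, (∀ u : Fin m → ℝ, dotProduct u (N.mulVec u) ≤ 0) → Lf N ≤ 0) → ∃ Λ : Matrix (Fin m) (Fin m) ℝ, Λ.PosSemidef ∧ ∀ Y : Matrix (Fin m) (Fin m) ℝ, Lf Y = (Y * Λ).trace :=
  fun _ Lf hD => ShadowSlack.exists_psd_repr Lf hD

end Summit.ValiantsHypothesis.ValiantsHypothesis.Theorems.PermanentalConesPermanentalConeHard
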